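import Literature.Probability.Entropy.PinskerInequality
import Summits.Ventures.LatticeQCDFlow.Scaling.Acceptance
import HarnessLib

/-!
# LatticeQCDFlow / Scaling — the trained objective floors the acceptance: `acc ≥ 1 − √(2·D_KL(q‖p))`

HONEST FRAMING: exact (Metropolis-corrected) sampling algorithms for lattice gauge theory;
figures of merit are autocorrelation/cost numbers at stated couplings and volumes; no
continuum-physics claim.

Venture `LatticeQCDFlow` (cell pub-lqcd), topic `Scaling`; FANOUT row 3 (`s0-u1-a`, rung S0-B
implementation A: the 2D U(1) flow trained by reverse KL and sampled by exact independence
Metropolis).  NEW WORK of the cell — a short corollary over the tree; the one cited fact it uses is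
Pinsker's inequality with the sharp constant, already in the tree as
`Literature.Probability.Entropy.two_mul_tvDist_sq_le_kl` [cite: PolyanskiyWu2024, Thm 7.10].
Finite state space `X`, target `p`, model `q`, both positive probability vectors;
`accRate p q = Σ_x Σ_y min (p x · q y) (p y · q x)` is the stationary acceptance of the flow
(independence-Metropolis) sampler (`Exactness/FlowMCMC.lean`), `klFin a b = Σ a log(a/b)`
(`Scaling/ImportanceWeights.lean`), `tvDist` the total-variation distance
(`Literature/Probability/MarkovChains/TotalVariation.lean`).

WHY (row 3's two monitored quantities).  A reverse-KL-trained flow reports, during training, the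
exact reverse divergence `D(q_θ‖p)` (the loss plus the known `log Z`), and, after sampling, the
Metropolis acceptance.  T2-X (`Theory2.one_sub_two_tvDist_le_accRate`: `acc ≥ 1 − 2‖p − q‖_TV`)
and Pinsker (`2‖p − q‖²_TV ≤ D`) combine into a MODEL-FREE FLOOR on the second from the first:

* `accRate_comm` — the acceptance functional is symmetric in (target, model);
* `two_mul_tvDist_le_sqrt_two_mul_klFin` — Pinsker in the form used here: `2·TV(p, q) ≤ √(2·D(p‖q))`;
* **`one_sub_sqrt_two_mul_klFin_le_accRate`** — `acc(p, q) ≥ 1 − √(2·D(p‖q))` (forward KL);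
* **`one_sub_sqrt_two_mul_klFin_rev_le_accRate`** — `acc(p, q) ≥ 1 − √(2·D(q‖p))` (REVERSE KL, the
  trained objective); non-vacuous exactly for `D < 1/2` nat;
* `half_le_accRate_of_klFin_rev_le` — the readable instance: `D(q‖p) ≤ 1/8` nat forces `acc ≥ 1/2`.

For orientation only (our own monitors, HOME/s0-u1-a/TRAINING-CURVES-A.md; nothing typed, no
sealed value): arm A's β = 1 cell has `D(q‖p) = 0.11–0.19` at its checkpoints, so the floor reads
`0.38–0.53` against the measured chain acceptance `0.7134`; at β ≥ 2 the monitors read `D ≥ 1.07`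
and the floor is vacuous, consistent with the measured `0.295 … 0.005`.  The sibling floor from the
reweighting ESS is `Theory2.one_sub_sqrt_le_accRate` (`acc ≥ 1 − √(1/ESS − 1)`).  NOT CLAIMED: any
CEILING on the acceptance from `D(q‖p)` alone, nor anything about `τ_int` or per-sector weights
(`Scaling/AcceptanceTails.lean`, `Scaling/SectorBudget.lean` hold the tree's upper bounds).
-/

namespace Summit.Ventures.LatticeQCDFlow.Theory2

open Finset
open Literature.Probability.MarkovChains
open Summit.Ventures.LatticeQCDFlow.Exactness

variable {X : Type*} [Fintype X]

/-- The stationary independence-Metropolis acceptance `Σ_x Σ_y min (p x q y) (p y q x)` is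
symmetric under exchanging target and model. -/
theorem accRate_comm (p q : X → ℝ) : accRate p q = accRate q p := by
  unfold accRate
  rw [Finset.sum_comm]
  refine sum_congr rfl fun a _ => sum_congr rfl fun b _ => ?_
  rw [mul_comm (p b) (q a), mul_comm (p a) (q b)]

/-- Pinsker's inequality in the form `2·‖p − q‖_TV ≤ √(2·D_KL(p‖q))` for positive probability
vectors (from the tree's sharp-constant statement `2 TV² ≤ D` [cite: PolyanskiyWu2024, Thm 7.10]). -/
theorem two_mul_tvDist_le_sqrt_two_mul_klFin {p q : X → ℝ} (hp : ∀ x, 0 < p x)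
    (hq : ∀ x, 0 < q x) (hp1 : ∑ x, p x = 1) (hq1 : ∑ x, q x = 1) :
    2 * tvDist p q ≤ Real.sqrt (2 * klFin p q) := by
  classical
  have hpin : 2 * tvDist p q ^ 2 ≤ klFin p q :=
    Literature.Probability.Entropy.two_mul_tvDist_sq_le_kl hp hq hp1 hq1
  have h0 : 0 ≤ 2 * tvDist p q := mul_nonneg zero_le_two (tvDist_nonneg p q)
  rw [← Real.sqrt_sq h0]
  exact Real.sqrt_le_sqrt (by nlinarith [hpin])

/-- **Acceptance floor from the forward KL.**  `acc(p, q) ≥ 1 − √(2·D_KL(p‖q))`. -/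
theorem one_sub_sqrt_two_mul_klFin_le_accRate {p q : X → ℝ} (hp : ∀ x, 0 < p x)
    (hq : ∀ x, 0 < q x) (hp1 : ∑ x, p x = 1) (hq1 : ∑ x, q x = 1) :
    1 - Real.sqrt (2 * klFin p q) ≤ accRate p q := by
  have h1 := one_sub_two_tvDist_le_accRate hp1 (fun x => (hq x).le) hq1
  have h2 := two_mul_tvDist_le_sqrt_two_mul_klFin hp hq hp1 hq1
  linarith

/-- **Acceptance floor from the REVERSE KL (the trained objective).**
`acc(p, q) ≥ 1 − √(2·D_KL(q‖p))`: a flow trained to reverse divergence `D` nats from the target is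
accepted by the exact independence-Metropolis step at rate at least `1 − √(2D)` in equilibrium
(non-vacuous for `D < 1/2`). -/
theorem one_sub_sqrt_two_mul_klFin_rev_le_accRate {p q : X → ℝ} (hp : ∀ x, 0 < p x)
    (hq : ∀ x, 0 < q x) (hp1 : ∑ x, p x = 1) (hq1 : ∑ x, q x = 1) :
    1 - Real.sqrt (2 * klFin q p) ≤ accRate p q := by
  rw [accRate_comm]
  exact one_sub_sqrt_two_mul_klFin_le_accRate hq hp hq1 hp1

/-- Readable instance: a reverse KL of at most `1/8` nat forces an equilibrium acceptance of at
least one half. -/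
theorem half_le_accRate_of_klFin_rev_le {p q : X → ℝ} (hp : ∀ x, 0 < p x) (hq : ∀ x, 0 < q x)
    (hp1 : ∑ x, p x = 1) (hq1 : ∑ x, q x = 1) (hD : klFin q p ≤ 1 / 8) :
    1 / 2 ≤ accRate p q := by
  have h := one_sub_sqrt_two_mul_klFin_rev_le_accRate hp hq hp1 hq1
  have hs : Real.sqrt (2 * klFin q p) ≤ 1 / 2 := by
    rw [show (1 / 2 : ℝ) = Real.sqrt (1 / 4) by
      rw [show (1 / 4 : ℝ) = (1 / 2) ^ 2 by norm_num, Real.sqrt_sq (by norm_num)]]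
    exact Real.sqrt_le_sqrt (by linarith)
  linarith

end Summit.Ventures.LatticeQCDFlow.Theory2
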